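import Mathlib
import Summits.PneNP.PneNP.Theses.OneSlice
import Literature.Computability.Complexity.KarpCliqueNP
import Literature.Computability.Complexity.CircuitClassesProofs
import Literature.Computability.Complexity.CircuitComposition
import Literature.Computability.Complexity.CliqueApproximators
import Literature.Computability.Complexity.CliqueTestGraphs
import Literature.Computability.Complexity.GrowthBounds

/-!
# Route OneSlice — support item `CliqueCircuitsOfNPSubsetPPoly` (stmt-PneNP-2837)

`Summit.PneNP.PneNP.Theses.OneSlice.CliqueCircuitsOfNPSubsetPPoly`: if `NP ⊆ P/poly` then there
is an exponent `c₁` such that for every clique size `k`, for all large `n`, some `B₂`-circuit of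
size `≤ n ^ c₁` on the `C(n,2)` edge variables of `K_n` computes `k`-CLIQUE
(`x ↦ [¬ (graph of x).CliqueFree k]`).

Proof (Karp 1972 + Arora–Barak 2009, §6.1 plumbing, as planned on the item). `CLIQUE ∈ NP`
(`Literature.Computability.Complexity.CLIQUE_mem_NP`), so `CLIQUE ∈ SIZE(p)` for a polynomial
`p`: a `B₂`-circuit family `(C_N)` deciding the tree's language
`CLIQUE = (encodingGraph.pairBool encodingNatBool).toLanguage cliqueSet`. For fixed `(n, k)` the
instance code of `(⟨n, G_x⟩, k)` is `⟨⟨⟨n⟩₂, adjacency bits of G_x⟩, ⟨k⟩₂⟩`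
(`CliqueNP.instEnc_encode_eq`); every one of its `N(n,k) = 2 (2 |⟨n⟩₂| + 2 + n²) + 2 + |⟨k⟩₂|`
bits is a constant or an edge variable `x_{ij}` (`exists_cliqueCode_wires`: the code is a fixed
list of *wires* `Bool ⊕ KEdge n` evaluated at `x`), so it is produced by an input layer of
`N(n,k)` gates (`cktSize_wires`). Feeding it to `C_{N(n,k)}` (`CktSize.comp`,
`CircuitFamily.Decides.eval_eq`) gives a `B₂`-circuit of size `≤ N + p(N)` whose value is
`[code ∈ CLIQUE] = [¬ G_x.CliqueFree k]`. Finally `m + p(m) < m ^ K` for large `m`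
(`IsPBounded.eventually_lt_pow`) and `N(n,k) ≤ 4 n²` for `n ≥ |⟨k⟩₂| + 10` (`|⟨n⟩₂| ≤ n + 1`,
`TM2Pass.length_encodeNat_le_self`), so the size is
`≤ (4n²)^K ≤ n^{3K}` for `n ≥ 4`: `c₁ = 3K`, independent of `k`.

References: R. M. Karp, *Reducibility among combinatorial problems* (1972), §4 Main Theorem,
problem 3; S. Arora, B. Barak, *Computational Complexity* (2009), Def. 6.1–6.5, §6.1.
-/

namespace Summit.PneNP.PneNP.Theorems

open Literature.Computability.Complexity _root_.Computability Filter

section CliqueCode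

variable {ι : Type*}

/-- A list of constant wires evaluates to the constants. [folklore] -/
theorem map_wire_const (l : List Bool) (x : ι → Bool) :
    (l.map Sum.inl : List (Bool ⊕ ι)).map (Sum.elim id x) = l := by
  rw [List.map_map]
  simp

/-- Pairing two wired strings is a wired string: double the wires of the first component, add
the two constant separator wires `0, 1`, append the second (Arora–Barak 2009, §0.1 pairing).
[folklore] -/
theorem boolPair_map_wire (ws vs : List (Bool ⊕ ι)) (x : ι → Bool) :
    boolPair (ws.map (Sum.elim id x)) (vs.map (Sum.elim id x)) =
      ((ws.flatMap fun w => [w, w]) ++ [Sum.inl false, Sum.inl true] ++ vs).map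
        (Sum.elim id x) := by
  simp [boolPair, List.map_append, List.map_flatMap, List.flatMap_map]

/-- The adjacency bits of the graph of an edge vector `x` are wired: bit `(i, j)` is the constant
`0` on the diagonal and the edge variable `x_{ij}` off it. [folklore] -/
theorem adjBits_cliqueGraph_eq_map {n : ℕ} (x : KEdge n → Bool) :
    CliqueNP.adjBits n (cliqueGraph x) =
      (List.ofFn fun t : Fin (n * n) =>
        if h : t.divNat = t.modNat then (Sum.inl false : Bool ⊕ KEdge n)
        else Sum.inr ⟨s(t.divNat, t.modNat), by simpa using h⟩).map (Sum.elim id x) := by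
  rw [List.map_ofFn]
  unfold CliqueNP.adjBits
  refine congrArg List.ofFn (funext fun t => ?_)
  simp only [Function.comp_apply]
  split_ifs with h
  · rw [h]
    simp
  · rw [Sum.elim_inr, Bool.eq_iff_iff]
    simp only [decide_eq_true_eq]
    rw [cliqueGraph_adj]
    exact ⟨fun ⟨_, hx⟩ => hx, fun hx => ⟨h, hx⟩⟩

/-- **The `CLIQUE` instance code is wired.** For fixed `n, k` there is one list of wires
(constants and edge variables) whose evaluation at every edge vector `x` is the code of the
instance `(⟨n, G_x⟩, k)`. [folklore] -/
theorem exists_cliqueCode_wires (n k : ℕ) : ∃ ws : List (Bool ⊕ KEdge n), ∀ x : KEdge n → Bool,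
    CliqueNP.instEnc.encode (⟨n, cliqueGraph x⟩, k) = ws.map (Sum.elim id x) := by
  refine ⟨((((encodeNat n).map Sum.inl : List (Bool ⊕ KEdge n)).flatMap fun w => [w, w]) ++
      [Sum.inl false, Sum.inl true] ++
      (List.ofFn fun t : Fin (n * n) =>
        if h : t.divNat = t.modNat then (Sum.inl false : Bool ⊕ KEdge n)
        else Sum.inr ⟨s(t.divNat, t.modNat), by simpa using h⟩)).flatMap (fun w => [w, w]) ++
      [Sum.inl false, Sum.inl true] ++ ((encodeNat k).map Sum.inl : List (Bool ⊕ KEdge n)),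
    fun x => ?_⟩
  conv_lhs =>
    rw [CliqueNP.instEnc_encode_eq, adjBits_cliqueGraph_eq_map, ← map_wire_const (encodeNat n) x,
      boolPair_map_wire, ← map_wire_const (encodeNat k) x, boolPair_map_wire]

/-- The length of the instance code: `2 (2 |⟨n⟩₂| + 2 + n²) + 2 + |⟨k⟩₂|`. [folklore] -/
theorem length_cliqueCode (n k : ℕ) (G : SimpleGraph (Fin n)) :
    (CliqueNP.instEnc.encode (⟨n, G⟩, k)).length =
      2 * (2 * (encodeNat n).length + 2 + n * n) + 2 + (encodeNat k).length := by
  rw [CliqueNP.instEnc_encode_eq, length_boolPair, length_boolPair, CliqueNP.length_adjBits]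

/-- **The input layer.** A list of wires, read as a multi-output map, costs at most one gate per
wire over `B₂` (a constant gate for a constant wire, nothing for a variable). [folklore] -/
theorem cktSize_wires (ws : List (Bool ⊕ ι)) :
    CktSize B2 (fun (x : ι → Bool) (j : Fin ws.length) => Sum.elim id x ws[(j : ℕ)]) ws.length := by
  have h := CktSize.pi_const (B := B2) (κ := Fin ws.length) (s := 1)
    (f := fun (x : ι → Bool) (j : Fin ws.length) => Sum.elim id x ws[(j : ℕ)]) fun j => ?_
  · simpa using h
  · cases hj : ws[(j : ℕ)] with
    | inl b =>
      exact (cktSize_const ι b).congr fun x _ => rfl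
    | inr i =>
      exact ((CktSize.proj B2 fun _ : Unit => i).of_le (Nat.zero_le 1)).congr fun x _ => rfl

/-- **From a circuit family for `CLIQUE` to a circuit on edge variables.** If the `B₂`-family `C`
of size `≤ p` decides `CLIQUE`, and the instance code at `(n, k)` is wired by `ws`, then a
`B₂`-circuit of size `≤ |ws| + p |ws|` on the edge variables of `K_n` outputs
`[code (⟨n, G_x⟩, k) ∈ CLIQUE]` (Arora–Barak 2009, §6.1). [folklore] -/
theorem exists_circuit_of_decides_CLIQUE {n k : ℕ} {C : CircuitFamily} {p : Polynomial ℕ}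
    (hC : ∀ m, (C m).IsOver B2 ∧ (C m).size ≤ p.eval m) (hDec : C.Decides CLIQUE)
    (ws : List (Bool ⊕ KEdge n))
    (hws : ∀ x : KEdge n → Bool,
      CliqueNP.instEnc.encode (⟨n, cliqueGraph x⟩, k) = ws.map (Sum.elim id x)) :
    ∃ C' : Circuit (KEdge n), C'.IsOver B2 ∧ C'.size ≤ ws.length + p.eval ws.length ∧
      ∀ x, C'.eval x = CLIQUE.boolIndicator (CliqueNP.instEnc.encode (⟨n, cliqueGraph x⟩, k)) := by
  have hcomp := (cktSize_wires ws).comp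
    (((C ws.length).cktSize_eval (hC ws.length).1).of_le (hC ws.length).2)
  obtain ⟨C', hB, hs, hev⟩ := hcomp.toCircuit
  refine ⟨C', hB, hs, fun x => ?_⟩
  rw [hev x]
  show (C ws.length).eval (fun j : Fin ws.length => Sum.elim id x ws[(j : ℕ)]) = _
  rw [hDec.eval_eq, List.ofFn_getElem_eq_map, ← hws x]

end CliqueCode

/-- **Item `CliqueCircuitsOfNPSubsetPPoly` (stmt-PneNP-2837).** `NP ⊆ P/poly` gives an exponent
`c₁` such that for every `k`, eventually in `n`, `k`-CLIQUE on the edges of `K_n` has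
`B₂`-circuits of size `≤ n ^ c₁` (Karp 1972: `CLIQUE ∈ NP`; Arora–Barak 2009, §6.1).
[folklore] -/
theorem cliqueCircuitsOfNPSubsetPPoly_proof :
    Summit.PneNP.PneNP.Theses.OneSlice.CliqueCircuitsOfNPSubsetPPoly := by
  unfold Summit.PneNP.PneNP.Theses.OneSlice.CliqueCircuitsOfNPSubsetPPoly
  intro hNP
  obtain ⟨p, C, hC, hDec⟩ := Set.mem_iUnion.1 (hNP CLIQUE_mem_NP)
  have hpb : Literature.Computability.AlgebraicComplexity.IsPBounded fun m => m + p.eval m :=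
    Literature.Computability.AlgebraicComplexity.IsPBounded.add_holds
      Literature.Computability.AlgebraicComplexity.IsPBounded.id
      ((Literature.Computability.AlgebraicComplexity.isPBounded_iff_exists_polynomial_holds _).2
        ⟨p, fun _ => le_rfl⟩)
  obtain ⟨K, hK⟩ := hpb.eventually_lt_pow
  obtain ⟨m₀, hm₀⟩ := eventually_atTop.1 hK
  refine ⟨3 * K, fun k =>
    eventually_atTop.2 ⟨max (max 4 m₀) ((encodeNat k).length + 10), fun n hn => ?_⟩⟩
  have h4 : 4 ≤ n := le_trans (le_max_left _ _) (le_trans (le_max_left _ _) hn)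
  have hm : m₀ ≤ n := le_trans (le_max_right _ _) (le_trans (le_max_left _ _) hn)
  have hk10 : (encodeNat k).length + 10 ≤ n := le_trans (le_max_right _ _) hn
  obtain ⟨ws, hws⟩ := exists_cliqueCode_wires n k
  obtain ⟨C', hB, hs, hev⟩ := exists_circuit_of_decides_CLIQUE hC hDec ws hws
  have hlen :
      ws.length = 2 * (2 * (encodeNat n).length + 2 + n * n) + 2 + (encodeNat k).length := by
    rw [← length_cliqueCode n k (cliqueGraph fun _ => false), hws, List.length_map]
  -- the size bound
  have hN4 : ws.length ≤ 4 * n ^ 2 := by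
    have h1 := TM2Pass.length_encodeNat_le_self n
    have h2 : ws.length ≤ 2 * n ^ 2 + 5 * n := by rw [hlen]; nlinarith
    nlinarith
  have hNm : m₀ ≤ ws.length := by
    rw [hlen]; nlinarith [Nat.le_mul_self n]
  have hsize : ws.length + p.eval ws.length ≤ n ^ (3 * K) := by
    have h1 := (hm₀ _ hNm).le
    have h2 : ws.length ^ K ≤ (4 * n ^ 2) ^ K := Nat.pow_le_pow_left hN4 K
    have h3 : (4 * n ^ 2) ^ K ≤ (n ^ 3) ^ K := by
      refine Nat.pow_le_pow_left ?_ K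
      calc 4 * n ^ 2 ≤ n * n ^ 2 := Nat.mul_le_mul_right _ h4
        _ = n ^ 3 := by ring
    rw [pow_mul]
    exact h1.trans (h2.trans h3)
  refine ⟨C', hB, fun x => ?_, hs.trans hsize⟩
  dsimp only
  rw [hev x]
  by_cases hfree : (cliqueGraph x).CliqueFree k
  · have hmem : CliqueNP.instEnc.encode (⟨n, cliqueGraph x⟩, k) ∉ CLIQUE := by
      unfold CLIQUE
      rw [Computability.Encoding.mem_toLanguage_iff]
      exact fun h => h hfree
    rw [(Set.notMem_iff_boolIndicator _ _).1 hmem]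
    symm
    exact (@decide_eq_false _ (_) (not_not_intro hfree))
  · have hmem : CliqueNP.instEnc.encode (⟨n, cliqueGraph x⟩, k) ∈ CLIQUE := by
      unfold CLIQUE
      rw [Computability.Encoding.mem_toLanguage_iff]
      exact hfree
    rw [(Set.mem_iff_boolIndicator _ _).1 hmem]
    symm
    exact (@decide_eq_true _ (_) hfree)

end Summit.PneNP.PneNP.Theorems
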